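import Literature.NumberTheory.Automorphic.UnitaryGroupLineBorelModulus      -- ★ p842532: `δ_{B₂}` on `T₂` (`deltaChar_cmBorel_torus_two`, `rootDeltaChar_cmBorel_torus_two`)
import Literature.NumberTheory.Automorphic.CMPrincipalSeriesSpherical       -- ★ `rootDeltaChar_eq_one_of_mem_of_isClosed_of_isCompact`, `deltaChar_eq_one_of_mem_of_isCompact`
import Literature.NumberTheory.Automorphic.CMPrincipalSeriesTraceKernel     -- ★ p841747: `exists_integral_eq_mul_integral_compact_borel`, Iwasawa `G = B·K_v`
import Literature.NumberTheory.Automorphic.JacquetModuleFrobeniusProofs     -- ★ `rootDeltaChar_eq_rootDeltaChar_inclusion_proj`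
import Literature.NumberTheory.Automorphic.JacquetNonzeroEmbedsNormalizedInd -- ★ `deltaChar_cmBorelTriple_eq_one_of_mem_N`
import Literature.NumberTheory.Automorphic.SmoothIndCellFunCompactSupport   -- ★ `SmoothInd.isLocallyConstant_toFun`
import Literature.NumberTheory.Rogawski1990.XiLocalCharacter                 -- ★ `OneDimAutRepH`, `localDet`, `torusLocalComponent`
import HarnessLib

/-!
# (H4, part 1∕2) — the `ξ₂`-SPHERICAL VECTOR of `i(χH₂)` on `U(Φ₂)(L⁺_v)` and the dictionary `τ = ξ₂ · δ_{B₂}` on `B₂`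

Cell hodgecm-mathlib (FLOOR 0), crux `H413` = `stmt-HodgeConjecture-24833`, line «CMCharIdentityTest» (ED. 11), joint (N-H-ii′) ⟸ (JH₂) ⟸
(H3) + (H4) (+ (EIG) ★) — ★ junction `F0P3bU2PrincipalSeriesJHOfBricks.uTwoPrincipalSeriesJH_of_bricks` (p842461).  THIS FILE (theorems only; no `def`,
no named fact, no `sorry`) is the first half of (H4) «`ξ₂ = (η_v ψ_v) ∘ det` is a quotient of `i(χH₂)`»; the functional itself is
`F0P3bU2XiQuotientFunctional.xi_quotient_functional` (part 2∕2).
* §1 THE DICTIONARY ON `B₂`: the inducing character `τ(b) = χH₂(proj b) δ_{B₂}^{1∕2}(b)` of `i(χH₂)` equals `ξ₂(b) · δ_{B₂}(b)` (`det n = 1` on `N₂`,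
  `det d(α, ᾱ⁻¹) = α ᾱ⁻¹ = quotConj α`, `δ_{B₂}^{1∕2}(b) = ‖(proj b)₀₀‖^{1∕2}` ★ `rootDeltaChar_cmBorel_torus_two`).
* §2a `K_v` compact open with `G₂ = B₂ · K_v` at the subtype spelling (★ `isCompact_isOpen_cmLocalIntegralLevel`, ★ `exists_borel_mul_mem_cmLocalIntegralLevel`).
* §2 THE `ξ₂`-SPHERICAL VECTOR `f₀ ∈ i(χH₂)`, `f₀(b κ) = τ(b) ξ₂(κ)` (`κ ∈ K_v`; well defined since `τ = ξ₂` on `B ∩ K_v`: `δ_{B₂} = 1` on the compact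
  `B ∩ K_v`).
HONEST LABEL: HC_CM is proved only modulo the 2 remaining named inputs (hLiu418, h413) until rung 0 closes.

## References
* [Rogawski1990] J. D. Rogawski, *Automorphic Representations of Unitary Groups in Three Variables* (1990), §12.1 case (1) pp. 171–172, §4.5 p. 45.
* [Casselman1995] W. Casselman, *Introduction to the theory of admissible representations of p-adic reductive groups* (1995), §3.1, Prop. 6.4.1.
* [CartierCorvallis1979] P. Cartier, *Representations of p-adic groups: a survey*, PSPM 33.1 (1979), §III.3–§IV.1.
-/

set_option autoImplicit false
set_option linter.dupNamespace false

noncomputable section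

open NumberField IsDedekindDomain MeasureTheory
open scoped Matrix MatrixGroups NNReal
open Literature.NumberTheory.Rogawski1990 Literature.NumberTheory.Automorphic Literature.NumberTheory.Automorphic.UnitaryGroup
open Literature.NumberTheory.GaloisRepresentations

namespace Summit.HodgeConjecture.HodgeConjecture.Cruxes.H413.F0P3bU2XiSphericalVector

variable (L : Type) [Field L] [NumberField L] [IsCMField L] (v : HeightOneSpectrum (𝓞 ↥(maximalRealSubfield L)))

/-! ## §1 The dictionary on `B₂`: `τ(b) = ξ₂(b) · δ_{B₂}(b)` -/

/-- **`det = 1` on `N₂(L⁺_v)`** (upper unitriangular). [cite: Rogawski1990, §1.10 p. 9] -/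
theorem localDet_eq_one_of_mem_N {n : ↥(unitaryGroupOfForm (conjLocal L (IsCMField.complexConj L) v) (cmLocalForm L 2 v))}
    (hn : n ∈ (cmBorelTriple L 2 v).N) :
    localDet (IsCMField.complexConj L) v (isUnit_antidiagOne_det L 2)
      (J := Matrix.of fun i j : Fin 2 => if i.val + j.val + 1 = 2 then (1 : L) else 0) n = 1 := by
  obtain ⟨hbt, hdiag⟩ := (mem_unipotentU_iff n).1 hn
  refine Subtype.ext (Units.ext ?_)
  rw [coe_localDet, Matrix.GeneralLinearGroup.val_det_apply, Matrix.det_of_upperTriangular hbt]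
  simp [hdiag]

/-- **On `T₂`: `det t = t₀₀ · σ(t₀₀)⁻¹ = quotConj t₀₀`** as norm-one units (`t = diag(d₀, d₁)`, `σ(d₀) d₁ = 1`). [cite: Rogawski1990, §12.1 p. 171] -/
theorem localDet_torus_eq_quotConj (t : ↥(torusU (conjLocal L (IsCMField.complexConj L) v) (cmLocalForm L 2 v))) :
    localDet (IsCMField.complexConj L) v (isUnit_antidiagOne_det L 2)
        (J := Matrix.of fun i j : Fin 2 => if i.val + j.val + 1 = 2 then (1 : L) else 0)
        (t : ↥(unitaryGroupOfForm (conjLocal L (IsCMField.complexConj L) v) (cmLocalForm L 2 v))) =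
      quotConj (conjLocal L (IsCMField.complexConj L) v) (conjLocal_conjLocal_cm L v)
        (torusEntry (conjLocal L (IsCMField.complexConj L) v) (cmLocalForm L 2 v) 0 t) := by
  obtain ⟨d, hd⟩ := (mem_torusU_iff _).1 t.2
  obtain ⟨-, h01⟩ := LineRing.torus_relations_two (conjLocal L (IsCMField.complexConj L) v) (cmLocalForm_eq_over L 2 v) t hd
  refine Subtype.ext ?_
  rw [coe_quotConj, torusEntry_eq_of_glDiagonal_eq _ _ 0 t d hd]
  refine Units.ext ?_
  rw [coe_localDet, Matrix.GeneralLinearGroup.val_det_apply, ← hd, coe_glDiagonal, Matrix.det_diagonal, Fin.prod_univ_two, Units.val_mul]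
  -- `d₁ = σ(d₀)⁻¹`
  have hσd : ((Units.map (conjLocal L (IsCMField.complexConj L) v : LocalRing L v →* LocalRing L v) (d 0))⁻¹ : (LocalRing L v)ˣ) = d 1 := by
    refine inv_eq_of_mul_eq_one_right (Units.ext ?_)
    rw [Units.val_mul, Units.coe_map, MonoidHom.coe_coe, Units.val_one]
    exact h01
  rw [hσd]

set_option synthInstance.maxHeartbeats 400000 in
set_option maxHeartbeats 1600000 in
/-- **THE DICTIONARY**: for `b ∈ B₂(L⁺_v)` and `z ∈ ℂ`, the inducing character of `i(χH₂)` acts by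
`τ(b) z = δ_{B₂}^{1∕2}(b) χH₂(proj b) z = (ξ₂(b) · δ_{B₂}(b)) · z`, `ξ₂(b) = η_v(det b) ψ_v(det b)` (`δ_{B₂}^{1∕2}` depends on `proj b` only and equals
`‖(proj b)₀₀‖^{1∕2}`; `det b = det (proj b) = quotConj (proj b)₀₀`). [cite: Rogawski1990, §12.1 pp. 171–172] [cite: BernsteinZelevinsky1977, §2.3] -/
theorem twist_borel_apply_eq (ξ : OneDimAutRepH L) (b : ↥(cmBorelTriple L 2 v).P) (z : ℂ) :
    haveI := locallyCompactSpace_cmBorelU L 2 v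
    (Representation.twist
        (((Representation.trivial ℂ ↥(torusU (conjLocal L (IsCMField.complexConj L) v) (cmLocalForm L 2 v)) ℂ).twist
          (torusCharPair (conjLocal L (IsCMField.complexConj L) v) (cmLocalForm L 2 v) (cmLocalForm_eq_over L 2 v) 0
            ((torusLocalComponent L (IsCMField.complexConj L) v ξ.η).comp
                (quotConj (conjLocal L (IsCMField.complexConj L) v) (conjLocal_conjLocal_cm L v)) *
              halfModulusChar (UnitaryGroup.LocalRing L v))
            (torusLocalComponent L (IsCMField.complexConj L) v ξ.ψ))).comp (cmBorelTriple L 2 v).proj)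
        (rootDeltaChar (cmBorelTriple L 2 v).P)) b z =
      ((torusLocalComponent L (IsCMField.complexConj L) v ξ.η
            (localDet (IsCMField.complexConj L) v (isUnit_antidiagOne_det L 2)
              (b : ↥(unitaryGroupOfForm (conjLocal L (IsCMField.complexConj L) v) (cmLocalForm L 2 v)))) *
          torusLocalComponent L (IsCMField.complexConj L) v ξ.ψ
            (localDet (IsCMField.complexConj L) v (isUnit_antidiagOne_det L 2)
              (b : ↥(unitaryGroupOfForm (conjLocal L (IsCMField.complexConj L) v) (cmLocalForm L 2 v)))) : ℂˣ) : ℂ) *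
        ((deltaChar (cmBorelTriple L 2 v).P b : ℂˣ) : ℂ) * z := by
  haveI := locallyCompactSpace_cmBorelU L 2 v
  set t := (cmBorelTriple L 2 v).proj b with ht
  -- `det b = det t`
  have hn : (((Subgroup.inclusion (cmBorelTriple L 2 v).M_le t)⁻¹ * b : ↥(cmBorelTriple L 2 v).P) :
      ↥(unitaryGroupOfForm (conjLocal L (IsCMField.complexConj L) v) (cmLocalForm L 2 v))) ∈ (cmBorelTriple L 2 v).N :=
    (cmBorelTriple L 2 v).coe_inclusion_proj_inv_mul_mem b
  have hdet : localDet (IsCMField.complexConj L) v (isUnit_antidiagOne_det L 2)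
        (J := Matrix.of fun i j : Fin 2 => if i.val + j.val + 1 = 2 then (1 : L) else 0)
        (b : ↥(unitaryGroupOfForm (conjLocal L (IsCMField.complexConj L) v) (cmLocalForm L 2 v))) =
      localDet (IsCMField.complexConj L) v (isUnit_antidiagOne_det L 2)
        (J := Matrix.of fun i j : Fin 2 => if i.val + j.val + 1 = 2 then (1 : L) else 0)
        (t : ↥(unitaryGroupOfForm (conjLocal L (IsCMField.complexConj L) v) (cmLocalForm L 2 v))) := by
    have e : (b : ↥(unitaryGroupOfForm (conjLocal L (IsCMField.complexConj L) v) (cmLocalForm L 2 v))) =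
        (t : ↥(unitaryGroupOfForm (conjLocal L (IsCMField.complexConj L) v) (cmLocalForm L 2 v))) *
          (((Subgroup.inclusion (cmBorelTriple L 2 v).M_le t)⁻¹ * b : ↥(cmBorelTriple L 2 v).P) :
            ↥(unitaryGroupOfForm (conjLocal L (IsCMField.complexConj L) v) (cmLocalForm L 2 v))) := by
      rw [Subgroup.coe_mul, Subgroup.coe_inv, Subgroup.coe_inclusion, mul_inv_cancel_left]
    rw [e]
    refine ((localDet (IsCMField.complexConj L) v (isUnit_antidiagOne_det L 2)
      (J := Matrix.of fun i j : Fin 2 => if i.val + j.val + 1 = 2 then (1 : L) else 0)).map_mul _ _).trans ?_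
    rw [localDet_eq_one_of_mem_N L v hn, mul_one]
  -- `δ^{1/2}(b) = δ^{1/2}(t) = ‖t₀₀‖^{1/2}`, `δ(b) = ‖t₀₀‖`
  have hroot : rootDeltaChar (cmBorelTriple L 2 v).P b = halfModulusChar (LocalRing L v) (torusEntry (conjLocal L (IsCMField.complexConj L) v) (cmLocalForm L 2 v) 0 t) := by
    rw [rootDeltaChar_eq_rootDeltaChar_inclusion_proj (cmBorelTriple L 2 v) (deltaChar_cmBorelTriple_eq_one_of_mem_N L 2 v) b]
    exact rootDeltaChar_cmBorel_torus_two L v t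
  have hdelta : ((deltaChar (cmBorelTriple L 2 v).P b : ℂˣ) : ℂ) =
      ((halfModulusChar (LocalRing L v) (torusEntry (conjLocal L (IsCMField.complexConj L) v) (cmLocalForm L 2 v) 0 t) : ℂˣ) : ℂ) *
        ((halfModulusChar (LocalRing L v) (torusEntry (conjLocal L (IsCMField.complexConj L) v) (cmLocalForm L 2 v) 0 t) : ℂˣ) : ℂ) := by
    have h2 : ((deltaChar (cmBorelTriple L 2 v).P b : ℂˣ) : ℂ) =
        ((rootDeltaChar (cmBorelTriple L 2 v).P b : ℂˣ) : ℂ) * ((rootDeltaChar (cmBorelTriple L 2 v).P b : ℂˣ) : ℂ) := by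
      rw [deltaChar_apply, rootDeltaChar_apply, ← Complex.ofReal_mul, ← NNReal.coe_mul, NNReal.mul_self_sqrt]
    rw [h2, hroot]
  rw [Representation.twist_apply, smul_eq_mul, MonoidHom.comp_apply, Representation.twist_apply, Representation.trivial_apply, smul_eq_mul,
    torusCharPair_apply, MonoidHom.mul_apply, MonoidHom.comp_apply, ← localDet_torus_eq_quotConj L v t, ← ht, hroot, hdelta, hdet]
  -- `torusDetNormOne t = localDet t`
  have hdn : torusDetNormOne (conjLocal L (IsCMField.complexConj L) v) (cmLocalForm L 2 v) (cmLocalForm_eq_over L 2 v) t =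
      localDet (IsCMField.complexConj L) v (isUnit_antidiagOne_det L 2)
        (J := Matrix.of fun i j : Fin 2 => if i.val + j.val + 1 = 2 then (1 : L) else 0)
        (t : ↥(unitaryGroupOfForm (conjLocal L (IsCMField.complexConj L) v) (cmLocalForm L 2 v))) :=
    Subtype.ext (Units.ext rfl)
  rw [hdn]
  push_cast
  ring

/-! ## §2a A compact open `K` with `G = B · K` at the `G`-spelling (★ `cmLocalIntegralLevel`, ★ Iwasawa) -/

set_option synthInstance.maxHeartbeats 400000 in
set_option maxHeartbeats 4000000 in  -- ONE defeq `Subgroup ((cmDatum L 2 Φ₂).Local v) = Subgroup G` (★ `cmDatum_Local_eq`), paid here once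
/-- **`K_v = U(Φ₂)(𝒪_v)` as a compact open subgroup of `G₂ = ↥(unitaryGroupOfForm (c̄ ⊗ 1) (cmLocalForm L 2 v))` with `G₂ = B₂ · K_v`** (★
`isCompact_isOpen_cmLocalIntegralLevel`, ★ `exists_borel_mul_mem_cmLocalIntegralLevel`), packaged at the subtype spelling so that consumers pay the
`cmDatum` unfolding once. [cite: Rogawski1990, §4.5 p. 45] [cite: PlatonovRapinchuk1994, §5.1] -/
theorem exists_compact_open_iwasawa_two :
    ∃ KU : Subgroup ↥(unitaryGroupOfForm (conjLocal L (IsCMField.complexConj L) v) (cmLocalForm L 2 v)),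
      IsCompact (KU : Set ↥(unitaryGroupOfForm (conjLocal L (IsCMField.complexConj L) v) (cmLocalForm L 2 v))) ∧ IsOpen (KU : Set ↥(unitaryGroupOfForm (conjLocal L (IsCMField.complexConj L) v) (cmLocalForm L 2 v))) ∧
      ∀ g : ↥(unitaryGroupOfForm (conjLocal L (IsCMField.complexConj L) v) (cmLocalForm L 2 v)), ∃ h : ↥(cmBorelTriple L 2 v).P, ∃ κ ∈ KU, g = h * κ := by
  refine ⟨cmLocalIntegralLevel L 2 (Matrix.of fun i j : Fin 2 => if i.val + j.val + 1 = 2 then (1 : L) else 0) v, (isCompact_isOpen_cmLocalIntegralLevel L 2 _ v).1, (isCompact_isOpen_cmLocalIntegralLevel L 2 _ v).2, fun g => ?_⟩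
  obtain ⟨h, κ, hκ, hg⟩ := exists_borel_mul_mem_cmLocalIntegralLevel L 2 v g
  exact ⟨h, κ, hκ, hg⟩

/-! ## §2 The `ξ₂`-spherical vector `f₀(b κ) = ξ₂(b) δ_{B₂}(b) · ξ₂(κ)` -/

set_option synthInstance.maxHeartbeats 400000 in
set_option maxHeartbeats 1600000 in
/-- **THE `ξ₂`-SPHERICAL VECTOR OF `i(χH₂)`**: for any character `Ξ` of `G₂` with `Ξ(g) = η_v(det g) ψ_v(det g)` there is `f₀ ∈ i(χH₂)` with
`f₀(b κ) = Ξ(b) δ_{B₂}(b) Ξ(κ)` for `b ∈ B₂`, `κ ∈ K_v` (well defined because `δ_{B₂} = 1` on the compact `B₂ ∩ K_v`; smooth because it is right-invariant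
under the open `K_v ∩ ker Ξ`).  The pattern of ★ `Representation.exists_mem_fixedPoints_toFun_eq` with a character of `K`.
[cite: Rogawski1990, §4.5 p. 45, §12.1 p. 171] [cite: CartierCorvallis1979, §III.3] -/
theorem exists_xiSpherical (ξ : OneDimAutRepH L)
    (Ξ : ↥(unitaryGroupOfForm (conjLocal L (IsCMField.complexConj L) v) (cmLocalForm L 2 v)) →* ℂˣ)
    (hΞ : ∀ g, Ξ g = torusLocalComponent L (IsCMField.complexConj L) v ξ.η (localDet (IsCMField.complexConj L) v (isUnit_antidiagOne_det L 2) g) *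
      torusLocalComponent L (IsCMField.complexConj L) v ξ.ψ (localDet (IsCMField.complexConj L) v (isUnit_antidiagOne_det L 2) g))
    (hΞo : IsOpen ((Ξ.ker : Subgroup _) : Set ↥(unitaryGroupOfForm (conjLocal L (IsCMField.complexConj L) v) (cmLocalForm L 2 v))))
    (KU : Subgroup ↥(unitaryGroupOfForm (conjLocal L (IsCMField.complexConj L) v) (cmLocalForm L 2 v))) (hKc : IsCompact (KU : Set ↥(unitaryGroupOfForm (conjLocal L (IsCMField.complexConj L) v) (cmLocalForm L 2 v)))) (hKo : IsOpen (KU : Set ↥(unitaryGroupOfForm (conjLocal L (IsCMField.complexConj L) v) (cmLocalForm L 2 v))))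
    (hGK : ∀ g : ↥(unitaryGroupOfForm (conjLocal L (IsCMField.complexConj L) v) (cmLocalForm L 2 v)), ∃ h : ↥(cmBorelTriple L 2 v).P, ∃ κ ∈ KU, g = h * κ) :
    haveI := locallyCompactSpace_cmBorelU L 2 v
    ∃ f₀ : Representation.SmoothInd (cmBorelTriple L 2 v).P
        (Representation.twist
          (((Representation.trivial ℂ ↥(torusU (conjLocal L (IsCMField.complexConj L) v) (cmLocalForm L 2 v)) ℂ).twist
            (torusCharPair (conjLocal L (IsCMField.complexConj L) v) (cmLocalForm L 2 v) (cmLocalForm_eq_over L 2 v) 0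
              ((torusLocalComponent L (IsCMField.complexConj L) v ξ.η).comp
                  (quotConj (conjLocal L (IsCMField.complexConj L) v) (conjLocal_conjLocal_cm L v)) *
                halfModulusChar (UnitaryGroup.LocalRing L v))
              (torusLocalComponent L (IsCMField.complexConj L) v ξ.ψ))).comp (cmBorelTriple L 2 v).proj)
          (rootDeltaChar (cmBorelTriple L 2 v).P)),
      ∀ (b : ↥(cmBorelTriple L 2 v).P) (κ : ↥(unitaryGroupOfForm (conjLocal L (IsCMField.complexConj L) v) (cmLocalForm L 2 v))),
        κ ∈ KU →
        f₀.toFun ((b : ↥(unitaryGroupOfForm (conjLocal L (IsCMField.complexConj L) v) (cmLocalForm L 2 v))) * κ) =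
          ((Ξ b : ℂˣ) : ℂ) * ((deltaChar (cmBorelTriple L 2 v).P b : ℂˣ) : ℂ) * ((Ξ κ : ℂˣ) : ℂ) := by
  haveI := locallyCompactSpace_cmBorelU L 2 v
  classical
  -- Iwasawa `G = B · K`
  choose hh κκ hκκ hdec using hGK
  -- `K` is compact; `δ_{B₂} = 1` on `B₂ ∩ K`
  have hBcl : IsClosed (((cmBorelTriple L 2 v).P : Subgroup _) : Set ↥(unitaryGroupOfForm (conjLocal L (IsCMField.complexConj L) v) (cmLocalForm L 2 v))) :=
    isClosed_borelU _ _
  have hδ1 : ∀ c : ↥(cmBorelTriple L 2 v).P, (c : ↥(unitaryGroupOfForm (conjLocal L (IsCMField.complexConj L) v) (cmLocalForm L 2 v))) ∈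
      KU → deltaChar (cmBorelTriple L 2 v).P c = 1 := by
    intro c hc
    exact deltaChar_eq_one_of_mem_of_isCompact (cmBorelTriple L 2 v).P
      (C := KU.comap ((cmBorelTriple L 2 v).P).subtype)
      (hBcl.isClosedEmbedding_subtypeVal.isCompact_preimage hKc) hc
  -- the scalar `S(b) = Ξ(b) δ(b)` as a character of `B₂`
  set S : ↥(cmBorelTriple L 2 v).P →* ℂˣ := (Ξ.comp ((cmBorelTriple L 2 v).P).subtype) * deltaChar (cmBorelTriple L 2 v).P with hS
  have hSapp : ∀ b : ↥(cmBorelTriple L 2 v).P, S b = Ξ b * deltaChar (cmBorelTriple L 2 v).P b := fun b => rfl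
  -- well-definedness on `B · K_v`
  have hwd : ∀ (h h' : ↥(cmBorelTriple L 2 v).P) (κ κ' : ↥(unitaryGroupOfForm (conjLocal L (IsCMField.complexConj L) v) (cmLocalForm L 2 v))),
      κ ∈ KU → κ' ∈ KU → (h : ↥(unitaryGroupOfForm (conjLocal L (IsCMField.complexConj L) v) (cmLocalForm L 2 v))) * κ = h' * κ' →
      ((S h : ℂˣ) : ℂ) * (Ξ κ : ℂ) = ((S h' : ℂˣ) : ℂ) * (Ξ κ' : ℂ) := by
    intro h h' κ κ' hκ hκ' heq
    -- `c := h'⁻¹ h ∈ B ∩ K_v`, `κ' = c κ`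
    have hcκ : ((h'⁻¹ * h : ↥(cmBorelTriple L 2 v).P) : ↥(unitaryGroupOfForm (conjLocal L (IsCMField.complexConj L) v) (cmLocalForm L 2 v))) * κ = κ' := by
      rw [Subgroup.coe_mul, Subgroup.coe_inv, mul_assoc, heq, inv_mul_cancel_left]
    have hcK : ((h'⁻¹ * h : ↥(cmBorelTriple L 2 v).P) : ↥(unitaryGroupOfForm (conjLocal L (IsCMField.complexConj L) v) (cmLocalForm L 2 v))) ∈
        KU := by
      have : ((h'⁻¹ * h : ↥(cmBorelTriple L 2 v).P) : ↥(unitaryGroupOfForm (conjLocal L (IsCMField.complexConj L) v) (cmLocalForm L 2 v))) = κ' * κ⁻¹ := by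
        rw [← hcκ, mul_inv_cancel_right]
      rw [this]
      exact Subgroup.mul_mem _ hκ' (Subgroup.inv_mem _ hκ)
    have hSc : S (h'⁻¹ * h) = Ξ ((h'⁻¹ * h : ↥(cmBorelTriple L 2 v).P) : ↥(unitaryGroupOfForm (conjLocal L (IsCMField.complexConj L) v) (cmLocalForm L 2 v))) := by
      rw [hSapp, hδ1 _ hcK, mul_one]
    have hh' : h = h' * (h'⁻¹ * h) := by rw [mul_inv_cancel_left]
    rw [← hcκ, map_mul, Units.val_mul, ← hSc]
    conv_lhs => rw [hh', map_mul, Units.val_mul]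
    ring
  -- the function
  let F : ↥(unitaryGroupOfForm (conjLocal L (IsCMField.complexConj L) v) (cmLocalForm L 2 v)) → ℂ := fun g => ((S (hh g) : ℂˣ) : ℂ) * (Ξ (κκ g) : ℂ)
  have hF : ∀ (g : ↥(unitaryGroupOfForm (conjLocal L (IsCMField.complexConj L) v) (cmLocalForm L 2 v))) (h : ↥(cmBorelTriple L 2 v).P)
      (κ : ↥(unitaryGroupOfForm (conjLocal L (IsCMField.complexConj L) v) (cmLocalForm L 2 v))), κ ∈ KU → g = h * κ → F g = ((S h : ℂˣ) : ℂ) * (Ξ κ : ℂ) := fun g h κ hκ hg =>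
    hwd (hh g) h (κκ g) κ (hκκ g) hκ ((hdec g).symm.trans hg)
  -- `B₂`-equivariance: `F(b g) = τ(b) F(g) = S(b) F(g)` (★ dictionary `twist_borel_apply_eq`)
  have hFmem : F ∈ Representation.coindV ((cmBorelTriple L 2 v).P).subtype
      (Representation.twist
        (((Representation.trivial ℂ ↥(torusU (conjLocal L (IsCMField.complexConj L) v) (cmLocalForm L 2 v)) ℂ).twist
          (torusCharPair (conjLocal L (IsCMField.complexConj L) v) (cmLocalForm L 2 v) (cmLocalForm_eq_over L 2 v) 0
            ((torusLocalComponent L (IsCMField.complexConj L) v ξ.η).comp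
                (quotConj (conjLocal L (IsCMField.complexConj L) v) (conjLocal_conjLocal_cm L v)) *
              halfModulusChar (UnitaryGroup.LocalRing L v))
            (torusLocalComponent L (IsCMField.complexConj L) v ξ.ψ))).comp (cmBorelTriple L 2 v).proj)
        (rootDeltaChar (cmBorelTriple L 2 v).P)) := by
    rw [Representation.mem_indFun_iff]
    intro b g
    rw [twist_borel_apply_eq L v ξ b (F g), ← hΞ]
    have e1 := hF ((b : ↥(unitaryGroupOfForm (conjLocal L (IsCMField.complexConj L) v) (cmLocalForm L 2 v))) * g) (b * hh g) (κκ g) (hκκ g)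
      (by rw [Subgroup.coe_mul, mul_assoc, ← hdec g])
    refine e1.trans ?_
    change ((S (b * hh g) : ℂˣ) : ℂ) * (Ξ (κκ g) : ℂ) =
      (Ξ (b : ↥(unitaryGroupOfForm (conjLocal L (IsCMField.complexConj L) v) (cmLocalForm L 2 v))) : ℂ) *
        (deltaChar (cmBorelTriple L 2 v).P b : ℂ) * (((S (hh g) : ℂˣ) : ℂ) * (Ξ (κκ g) : ℂ))
    rw [map_mul, Units.val_mul, hSapp b, Units.val_mul]
    ring
  -- right `K_v ∩ ker Ξ`-invariance ⇒ smooth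
  have hFK : ∀ κ₀ : ↥(unitaryGroupOfForm (conjLocal L (IsCMField.complexConj L) v) (cmLocalForm L 2 v)), κ₀ ∈ KU → Ξ κ₀ = 1 →
      ∀ x, F (x * κ₀) = F x := by
    intro κ₀ hκ₀ hΞ1 x
    rw [hF (x * κ₀) (hh x) (κκ x * κ₀) (Subgroup.mul_mem _ (hκκ x) hκ₀) (by rw [← mul_assoc, ← hdec x]), map_mul, hΞ1, mul_one]
  have hopen : IsOpen ((KU ⊓ Ξ.ker : Subgroup ↥(unitaryGroupOfForm (conjLocal L (IsCMField.complexConj L) v) (cmLocalForm L 2 v))) : Set ↥(unitaryGroupOfForm (conjLocal L (IsCMField.complexConj L) v) (cmLocalForm L 2 v))) := hKo.inter hΞo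
  have hFsm : (Representation.indFun ((cmBorelTriple L 2 v).P) (Representation.twist
        (((Representation.trivial ℂ ↥(torusU (conjLocal L (IsCMField.complexConj L) v) (cmLocalForm L 2 v)) ℂ).twist
          (torusCharPair (conjLocal L (IsCMField.complexConj L) v) (cmLocalForm L 2 v) (cmLocalForm_eq_over L 2 v) 0
            ((torusLocalComponent L (IsCMField.complexConj L) v ξ.η).comp
                (quotConj (conjLocal L (IsCMField.complexConj L) v) (conjLocal_conjLocal_cm L v)) *
              halfModulusChar (UnitaryGroup.LocalRing L v))
            (torusLocalComponent L (IsCMField.complexConj L) v ξ.ψ))).comp (cmBorelTriple L 2 v).proj)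
        (rootDeltaChar (cmBorelTriple L 2 v).P))).IsSmoothVector (⟨F, hFmem⟩ : Representation.coindV ((cmBorelTriple L 2 v).P).subtype (Representation.twist
        (((Representation.trivial ℂ ↥(torusU (conjLocal L (IsCMField.complexConj L) v) (cmLocalForm L 2 v)) ℂ).twist
          (torusCharPair (conjLocal L (IsCMField.complexConj L) v) (cmLocalForm L 2 v) (cmLocalForm_eq_over L 2 v) 0
            ((torusLocalComponent L (IsCMField.complexConj L) v ξ.η).comp
                (quotConj (conjLocal L (IsCMField.complexConj L) v) (conjLocal_conjLocal_cm L v)) *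
              halfModulusChar (UnitaryGroup.LocalRing L v))
            (torusLocalComponent L (IsCMField.complexConj L) v ξ.ψ))).comp (cmBorelTriple L 2 v).proj)
        (rootDeltaChar (cmBorelTriple L 2 v).P))) := by
    refine (Representation.indFun ((cmBorelTriple L 2 v).P) (Representation.twist
        (((Representation.trivial ℂ ↥(torusU (conjLocal L (IsCMField.complexConj L) v) (cmLocalForm L 2 v)) ℂ).twist
          (torusCharPair (conjLocal L (IsCMField.complexConj L) v) (cmLocalForm L 2 v) (cmLocalForm_eq_over L 2 v) 0
            ((torusLocalComponent L (IsCMField.complexConj L) v ξ.η).comp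
                (quotConj (conjLocal L (IsCMField.complexConj L) v) (conjLocal_conjLocal_cm L v)) *
              halfModulusChar (UnitaryGroup.LocalRing L v))
            (torusLocalComponent L (IsCMField.complexConj L) v ξ.ψ))).comp (cmBorelTriple L 2 v).proj)
        (rootDeltaChar (cmBorelTriple L 2 v).P))).isSmoothVector_of_le hopen fun κ hκ => ?_
    obtain ⟨hκK, hκΞ⟩ := Subgroup.mem_inf.1 hκ
    rw [Representation.mem_stabilizerSubgroup]
    exact Subtype.ext (funext fun x => hFK κ hκK ((MonoidHom.mem_ker).1 hκΞ) x)
  refine ⟨(⟨⟨F, hFmem⟩, hFsm⟩ : ↥(Representation.smoothInd ((cmBorelTriple L 2 v).P) (Representation.twist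
        (((Representation.trivial ℂ ↥(torusU (conjLocal L (IsCMField.complexConj L) v) (cmLocalForm L 2 v)) ℂ).twist
          (torusCharPair (conjLocal L (IsCMField.complexConj L) v) (cmLocalForm L 2 v) (cmLocalForm_eq_over L 2 v) 0
            ((torusLocalComponent L (IsCMField.complexConj L) v ξ.η).comp
                (quotConj (conjLocal L (IsCMField.complexConj L) v) (conjLocal_conjLocal_cm L v)) *
              halfModulusChar (UnitaryGroup.LocalRing L v))
            (torusLocalComponent L (IsCMField.complexConj L) v ξ.ψ))).comp (cmBorelTriple L 2 v).proj)
        (rootDeltaChar (cmBorelTriple L 2 v).P))).toSubmodule), fun b κ hκ => ?_⟩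
  change F _ = _
  rw [hF _ b κ hκ rfl, hSapp, Units.val_mul]

end Summit.HodgeConjecture.HodgeConjecture.Cruxes.H413.F0P3bU2XiSphericalVector

end
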